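import Literature.NumberTheory.EllipticCurves.TateCurve.ComplexTateAddition
import Literature.NumberTheory.EllipticCurves.TateCurve.UniformizationThetaZeros
import Literature.NumberTheory.EllipticCurves.WeierstrassSigmaQProductProofs
import Literature.NumberTheory.EllipticCurves.WeierstrassAdditionProofs
import HarnessLib

/-!
# The theta relation of the Tate curve over `ℂ`:
# `(X(u₁) − X(u₂)) θ(u₁)² θ(u₂)² = −u₂ θ(u₁u₂) θ(u₁u₂⁻¹)` (Silverman ATAEC Prop. V.3.2 (b)(i))

Topic `Literature/NumberTheory/EllipticCurves/TateCurve`, namespace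
`Literature.NumberTheory.EllipticCurves.TateCurve` (cell `bsd-eis`, seat `bsd-eis-k5-c4` g3; step T1
of the discharge of `SteinWuthrich2013.exists_isSplitMultCanonical`). Theorems only.

The COMPLEX instance of Silverman's theta relation Prop. V.3.2 (b)(i) (normalised
`θ(u,q) = (1−u)∏(1−qⁿu)(1−qⁿu⁻¹)/(1−qⁿ)²`, tree `TateCurve.tateTheta`), i.e. the classical
`℘(z) − ℘(w) = −σ(z−w)σ(z+w)/(σ(z)²σ(w)²)` (tree: `PeriodPair.weierstrassP_sub_eq_sigma_holds`)
transported along the `q`-dictionary `℘ = (2πi)²(X + 1/12)` (`weierstrassP_eq_tateX`) and the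
`q`-product of `σ` (ATAEC Thm. I.6.4, tree `weierstrassSigma_ofUpperHalfPlane_eq_qProduct_holds`):
`σ(z;τ) = −(2πi)⁻¹ e^{½η₂z²} e^{−πiz} θ(u,q)`; the elementary factors contribute exactly `(2πi)² u₂`.

* `one_sub_mul_tprod_eq_tateTheta` — the single `∏'` of the `σ`-product formula is `θ(u,q)`
  (`(1−u)∏'ₙ(1−q^{n+1}u)(1−q^{n+1}u⁻¹)/(1−q^{n+1})² = tateTheta q u`, any complete normed field);
* `weierstrassSigma_eq_tateTheta` — `σ(z;τ) = −(2πi)⁻¹ e^{½η₂z²} e^{−πiz} · tateTheta q u`;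
* **`complexTate_thetaRelation`** — for `q = e^{2πiτ}`, `u₁ = e^{2πiz}`, `u₂ = e^{2πiw}`,
  `0 < Im z, Im w < Im τ`:
  `(X(u₁) − X(u₂)) θ(u₁)² θ(u₂)² = −u₂ θ(u₁u₂) θ(u₁u₂⁻¹)`.

This is the numerical input of the identity principle (`LaurentSeriesIdentity2`) for the formal
theta relation `thetaRel` (`TateFormalThetaDefs`).

## References
* [SilvermanATAEC1994] J. H. Silverman, *Advanced Topics in the Arithmetic of Elliptic Curves*,
  GTM 151, Springer 1994, Prop. V.3.2 (b) (PDF pp. 399–400), Thm. I.6.4 (p. 57).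
* [ArmitageEberlein2001] eq. (7.63) (`℘(u) − ℘(v)` via `σ`).
-/

noncomputable section

open Complex Real Filter Topology
open UpperHalfPlane hiding I
open scoped PeriodPair

namespace Literature.NumberTheory.EllipticCurves.TateCurve

open SteinWuthrich2013

/-! ### The `σ`-product is `θ` -/

section Theta

variable {L : Type*} [NormedField L] [CompleteSpace L]

omit [CompleteSpace L] in
/-- In a normed field, `∏ f = a ≠ 0` gives `∏ f⁻¹ = a⁻¹`. [folklore] -/
private theorem hasProd_inv_of_ne_zero' {f : ℕ → L} {a : L} (h : HasProd f a) (ha : a ≠ 0) :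
    HasProd (fun n => (f n)⁻¹) a⁻¹ := by
  unfold HasProd at h ⊢
  have := h.inv₀ ha
  refine this.congr fun s => ?_
  exact (Finset.prod_inv_distrib (s := s) (f := f)).symm

/-- **The single product of the `σ`-formula is `θ(u,q)`**:
`(1−u) ∏'ₙ (1−q^{n+1}u)(1−q^{n+1}u⁻¹)/(1−q^{n+1})² = tateTheta q u` (`‖q‖ < 1`, complete field;
the three products converge separately, `hasProd_tateP`, and `P(1) ≠ 0`).
[cite: SilvermanATAEC1994, Prop. V.3.2 (a) (PDF p. 399)] -/
theorem one_sub_mul_tprod_eq_tateTheta {q : L} (hq : ‖q‖ < 1) (u : L) :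
    (1 - u) * ∏' n : ℕ, (1 - q ^ (n + 1) * u) * (1 - q ^ (n + 1) * u⁻¹) / (1 - q ^ (n + 1)) ^ 2 =
      tateTheta q u := by
  have hP1 : tateP q (1 : L) ≠ 0 := tateP_one_ne_zero hq
  have hnum := (hasProd_tateP hq u).mul (hasProd_tateP hq u⁻¹)
  have hden : HasProd (fun n : ℕ => ((1 - q ^ (n + 1) * (1 : L)) ^ 2)⁻¹) (tateP q 1 ^ 2)⁻¹ :=
    hasProd_inv_of_ne_zero' ((hasProd_tateP hq (1 : L)).pow 2) (pow_ne_zero 2 hP1)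
  have hall := hnum.mul hden
  have hfun : (fun n : ℕ => (1 - q ^ (n + 1) * u) * (1 - q ^ (n + 1) * u⁻¹) / (1 - q ^ (n + 1)) ^ 2) =
      fun n : ℕ => (1 - q ^ (n + 1) * u) * (1 - q ^ (n + 1) * u⁻¹) *
        ((1 - q ^ (n + 1) * (1 : L)) ^ 2)⁻¹ := by
    funext n; rw [mul_one, div_eq_mul_inv]
  rw [hfun, hall.tprod_eq]
  unfold tateTheta
  rw [div_eq_mul_inv]
  ring

end Theta

/-! ### `σ = −(2πi)⁻¹ e^{½η₂z²} e^{−πiz} θ` -/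

/-- `z ∉ ℤτ + ℤ` when `0 < Im z < Im τ`. [folklore] -/
private theorem notMem_lattice_of_im'' (τ : ℍ) {z : ℂ} (hz0 : 0 < z.im) (hz1 : z.im < τ.im) :
    z ∉ (PeriodPair.ofUpperHalfPlane τ).lattice := by
  intro hz
  rw [PeriodPair.mem_lattice] at hz
  obtain ⟨c, d, hcd⟩ := hz
  have him : z.im = (c : ℝ) * τ.im := by
    rw [← hcd]
    simp [PeriodPair.ofUpperHalfPlane]
  have hτ := τ.im_pos
  rcases le_or_gt c 0 with hc0 | hc0
  · have : (c : ℝ) * τ.im ≤ 0 := mul_nonpos_of_nonpos_of_nonneg (by exact_mod_cast hc0) hτ.le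
    linarith
  · have hc1 : (1 : ℝ) ≤ c := by exact_mod_cast hc0
    have : τ.im ≤ (c : ℝ) * τ.im := le_mul_of_one_le_left hτ.le hc1
    linarith

/-- **ATAEC Thm. I.6.4 in terms of `tateTheta`**: for `τ ∈ ℍ`, `q = e^{2πiτ}`, `u = e^{2πiz}`,
`σ(z; τ) = −(2πi)⁻¹ · e^{½η(1)z²} · e^{−πiz} · θ(u,q)`. [cite: SilvermanATAEC1994, Thm. I.6.4 (p. 57)] -/
theorem weierstrassSigma_eq_tateTheta (τ : ℍ) (z : ℂ) :
    (PeriodPair.ofUpperHalfPlane τ).weierstrassSigma z =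
      -(1 / (2 * π * I)) * cexp (1 / 2 * (PeriodPair.ofUpperHalfPlane τ).η₂ * z ^ 2) *
        cexp (-(π * I * z)) * tateTheta (cexp (2 * π * I * τ)) (cexp (2 * π * I * z)) := by
  have hq1 : ‖cexp (2 * π * I * τ)‖ < 1 := norm_exp_two_pi_I_lt_one τ
  rw [weierstrassSigma_ofUpperHalfPlane_eq_qProduct_holds τ z,
    ← one_sub_mul_tprod_eq_tateTheta hq1 (cexp (2 * π * I * z))]
  ring

/-! ### The theta relation over `ℂ` -/

/-- **Silverman ATAEC Prop. V.3.2 (b)(i) over `ℂ`**: for `q = e^{2πiτ}`, `u₁ = e^{2πiz}`,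
`u₂ = e^{2πiw}` with `0 < Im z < Im τ`, `0 < Im w < Im τ`,
`(X(u₁) − X(u₂)) θ(u₁)² θ(u₂)² = −u₂ θ(u₁u₂) θ(u₁u₂⁻¹)` — from
`℘(z) − ℘(w) = −σ(z−w)σ(z+w)/(σ(z)²σ(w)²)`, `℘ = (2πi)²(X + 1/12)` and
`σ = −(2πi)⁻¹e^{½η₂z²}e^{−πiz}θ`, the elementary factors giving
`e^{½η₂((z−w)²+(z+w)²−2z²−2w²)} e^{−πi((z−w)+(z+w)−2z−2w)} = e^{2πiw} = u₂`.
[cite: SilvermanATAEC1994, Prop. V.3.2 (b) (PDF pp. 399–400)] -/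
theorem complexTate_thetaRelation (τ : ℍ) {z w : ℂ} (hz : 0 < z.im) (hzτ : z.im < τ.im)
    (hw : 0 < w.im) (hwτ : w.im < τ.im) :
    let q := cexp (2 * π * I * τ)
    let u₁ := cexp (2 * π * I * z)
    let u₂ := cexp (2 * π * I * w)
    (tateX q u₁ - tateX q u₂) * tateTheta q u₁ ^ 2 * tateTheta q u₂ ^ 2 =
      -(u₂ * tateTheta q (u₁ * u₂) * tateTheta q (u₁ * u₂⁻¹)) := by
  intro q u₁ u₂
  set L := PeriodPair.ofUpperHalfPlane τ with hL
  have hc : (2 * π * I : ℂ) ≠ 0 := by simp [Real.pi_ne_zero, Complex.I_ne_zero]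
  have hnz : z ∉ L.lattice := notMem_lattice_of_im'' τ hz hzτ
  have hnw : w ∉ L.lattice := notMem_lattice_of_im'' τ hw hwτ
  -- the dictionary
  have hP1 := weierstrassP_eq_tateX τ hz hzτ
  have hP2 := weierstrassP_eq_tateX τ hw hwτ
  have hσz := weierstrassSigma_eq_tateTheta τ z
  have hσw := weierstrassSigma_eq_tateTheta τ w
  have hσp := weierstrassSigma_eq_tateTheta τ (z + w)
  have hσm := weierstrassSigma_eq_tateTheta τ (z - w)
  have hep : cexp (2 * π * I * (z + w)) = u₁ * u₂ := by rw [mul_add, Complex.exp_add]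
  have hem : cexp (2 * π * I * (z - w)) = u₁ * u₂⁻¹ := by
    rw [mul_sub, Complex.exp_sub, div_eq_mul_inv]
  rw [hep] at hσp
  rw [hem] at hσm
  -- the `σ` identity
  have hsub := L.weierstrassP_sub_eq_sigma_holds z w hnz hnw
  have hσz0 : L.weierstrassSigma z ≠ 0 := L.weierstrassSigma_ne_zero hnz
  have hσw0 : L.weierstrassSigma w ≠ 0 := L.weierstrassSigma_ne_zero hnw
  have hD : L.weierstrassSigma z ^ 2 * L.weierstrassSigma w ^ 2 ≠ 0 :=
    mul_ne_zero (pow_ne_zero 2 hσz0) (pow_ne_zero 2 hσw0)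
  have hsub' : (℘[L] z - ℘[L] w) * (L.weierstrassSigma z ^ 2 * L.weierstrassSigma w ^ 2) =
      -(L.weierstrassSigma (z - w) * L.weierstrassSigma (z + w)) := by
    rw [hsub, div_mul_cancel₀ _ hD]
  rw [hL] at hsub'
  rw [hP1, hP2, hσz, hσw, hσp, hσm] at hsub'
  -- abbreviations
  set c : ℂ := -(1 / (2 * π * I)) with hcdef
  set η : ℂ := (PeriodPair.ofUpperHalfPlane τ).η₂ with hη
  set e₁z := cexp (1 / 2 * η * z ^ 2)
  set e₂z := cexp (-(π * I * z))
  set e₁w := cexp (1 / 2 * η * w ^ 2)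
  set e₂w := cexp (-(π * I * w))
  set e₁p := cexp (1 / 2 * η * (z + w) ^ 2)
  set e₂p := cexp (-(π * I * (z + w)))
  set e₁m := cexp (1 / 2 * η * (z - w) ^ 2)
  set e₂m := cexp (-(π * I * (z - w)))
  set θ₁ := tateTheta q u₁
  set θ₂ := tateTheta q u₂
  set θ₃ := tateTheta q (u₁ * u₂)
  set θ₄ := tateTheta q (u₁ * u₂⁻¹)
  set X₁ := tateX q u₁
  set X₂ := tateX q u₂
  -- the elementary factors: `e(z−w) e(z+w) = u₂ · e(z)² e(w)²`
  have hE : e₁m * e₂m * (e₁p * e₂p) = u₂ * (e₁z * e₂z) ^ 2 * (e₁w * e₂w) ^ 2 := by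
    simp only [e₁m, e₂m, e₁p, e₂p, e₁z, e₂z, e₁w, e₂w, u₂, pow_two, ← Complex.exp_add, ← mul_assoc]
    congr 1
    ring
  have hc2 : (2 * π * I : ℂ) ^ 2 * c ^ 2 = 1 := by
    rw [hcdef]; field_simp
  have hK : c ^ 2 * (e₁z * e₂z) ^ 2 * (e₁w * e₂w) ^ 2 ≠ 0 := by
    have hc0 : c ≠ 0 := by rw [hcdef]; exact neg_ne_zero.mpr (one_div_ne_zero hc)
    have h1 : e₁z * e₂z ≠ 0 := mul_ne_zero (Complex.exp_ne_zero _) (Complex.exp_ne_zero _)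
    have h2 : e₁w * e₂w ≠ 0 := mul_ne_zero (Complex.exp_ne_zero _) (Complex.exp_ne_zero _)
    exact mul_ne_zero (mul_ne_zero (pow_ne_zero 2 hc0) (pow_ne_zero 2 h1)) (pow_ne_zero 2 h2)
  have key : c ^ 2 * (e₁z * e₂z) ^ 2 * (e₁w * e₂w) ^ 2 *
      ((X₁ - X₂) * θ₁ ^ 2 * θ₂ ^ 2 + u₂ * θ₃ * θ₄) = 0 := by
    linear_combination hsub' - c ^ 2 * θ₃ * θ₄ * hE
      - c ^ 2 * (e₁z * e₂z) ^ 2 * (e₁w * e₂w) ^ 2 * (X₁ - X₂) * θ₁ ^ 2 * θ₂ ^ 2 * hc2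
  have h0 := (mul_eq_zero.mp key).resolve_left hK
  linear_combination h0

end Literature.NumberTheory.EllipticCurves.TateCurve

end
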